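import Summits.QuantumFields.YangMills.Theorems.BalabanUVNodesN15UnitLayerBgExactDressingLetters
import Summits.QuantumFields.YangMills.Theorems.BalabanUVNodesN15FullPropagatorC2BgUnitN15At

/-!
# Route «BalabanUVNodes», cluster K4 «SpineRates» — node N15 = NE2, file V-D (dag-n15-a g17, programme V): `NE2PlusUnit` BY NAME WITH THE BACKGROUND LIVE THROUGH
# BAŁABAN's OWN NON-LINEAR DRESSING `Δ_k(U) := (Sym Q_kE₀(U)Q_k*)⁻¹ − b` of the (2.156) unit-lattice covariance — the exact (1.103) map applied to the operator layer's
# dressed propagator, WINDOW-FREE; and `N15At` for dag-n15-c's primitive-carrier family with TWO of the three layers reading `U`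

Cell `pub-ymgap`, seat `pub-ymgap-dag-n15-a` (-a KNIT-BY-NAME seat of node N15; HUMAN RULING D-0062; chair R424 venue), generation 17, file V-D of programme V
(INBOX «DAGN15A-G17-INTENT-1»).  `bears_on: R4∕N15 · K3⁷ SpineGivenEndpointR13SepCoPH (stmt-QuantumFields-20544)`.  Filed `--kind proof --supports stmt-QuantumFields-20544
--as helper` — COUNT-NEUTRAL.  Four data `def`s (`bgPertEx`, `covBgEx`, the site kernel `tgCovBgEx`, the `NE2Objects₁₁` literal `c2BgExObjects`), the rest theorems; 0 `sorry`.
Imports V-C (`exDress_deltaPol_letters`, `exDress_deltaPol_zero`, `smul_one_add_deltaPol_add_exDress_eq_inv_symPart`; through it V-A `sOp` and V-B `exDress`) and g16's U-D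
(`e0Op_zero`∕`zOp_zero`∕`rpow_pow_eq`∕`dvd_Mn_fg`, U-C3 `zOp_family_letters`, U-A `cov2156_rate_torus_add`∕`epsCov`, part 81's operator∕site conjuncts) BY NAME; nothing in the
tree is modified.  This is U-D with ONE token changed: the perturbation of THE (1.66) matrix is `exDress` (V-B) instead of U-B's linearisation `dressP`.

WHAT.
* §1 def `bgPertEx M n b c a := exDress b Δ^{(n)} (unitBondMat Z^{(n)}(c,a))`, def `covBgEx` (`C(C*(Δ^{(n)} + P_ex)C)⁻¹C*`), ★ `unitBondMat_qe0q` (`unitBondMat (Q E₀(U) Q*) =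
  unitBondMat (Q G Q*) + unitBondMat Z(U)`), ★★ **`deltaPol_add_bgPertEx`** — THE HONEST DICTIONARY: `b·1 + Δ^{(n)} + P_ex^{(n)}(U) = (Sym unitBondMat (Q_n E₀^{(n)}(U) Q_n*))⁻¹`, i.e. the
  dressed form IS `Δ_k(U) = (Sym Q E₀(U) Q*)⁻¹ − b` — Bałaban's (1.65)∕(1.103) definition of the effective operator evaluated at the dressed propagator ([B9] (3.185) shape),
  NOT a Taylor term; ★★ `deltaPol_add_bgPertEx_eq_inv_symProp` (the same with the symmetrised PROPAGATOR `E₀ˢ = ½(E₀ + E₀ᵀ)`: `= (unitBondMat (Q E₀ˢ Q*))⁻¹`); def `tgCovBgEx` (the U-seeing site kernel: fine run dressed at `U`, coarse run at the pairing's `Ū = avg U`), `tgCovBgEx_ker`, `bgPertEx_zero`,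
  ★ `tgCovBgEx_one` (at `U ≡ 1` the kernel IS part 76's genuine (2.156) difference `covDiff`).
* §2 ★★★ **`ne2PlusUnit_tgCovBgEx`**: `NE2PlusUnit c₃₅ (fgInstanceC2 d hL ∘ val) (tgCovBgEx d hL b α β ∘ val) ⊤ dist` on `FGIndexL d` — `d ≥ 1`, odd `L ≥ 3`, `b > 0`, `c₃₅ > 0`,
  every `α β`; constants `(δ₀, a₀, B₀, θ = L^{−1∕16})` after `d, L, b, c₃₅`; threshold `a₀ = min a₁ (min (ζ₀∕ζ) (ε₀∕(Kζ)))` — a smallness in `α₀` ALONE (V-C's `ζ₀` for the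
  Combes–Thomas coercivity margin, U-A's `epsCov` for (2.153)); `B₀ = C′(1 + K(τ+1)) + 1`; NO weight window, NO Neumann series; chain U-C3 `zOp_family_letters` → V-C `exDress_deltaPol_letters` → U-A
  `cov2156_rate_torus_add` VERBATIM.
* §3 ★★★ **`n15At_fullG_C2_bgEx`** (OPERATOR = n15-c FILE 11, UNIT = §2, SITE = G1's `U ≡ 1` scalar-sector kernel, U-blind — said), def `c2BgExObjects`,
  `ne2OfRecord₁₁_c2BgExObjects`, `n15At_c2BgExObjects`, `populated_c2BgExObjects`, keyed faces `s_N15_of_admits_C2BgEx(_family)`, `populated_c2BgExObjects_family`,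
  `n15At_c2BgExObjects_family`.

HONEST FRAMING.  Count-neutral composition BY NAME; MODEL-LEVEL exactly as U-D (dag-n15-c's by-parts background species = abelianised first-order coefficients with
block-averaged coarse partner; abelianised `Q`; `Sym` in the bond basis because the species' `E₀(U)` is not asserted symmetric) — the ONE upgrade over U-D: the dressing is
Bałaban's own non-linear map `E ↦ (Q E Q*)⁻¹ − b` ([B5] (1.65), (1.102)–(1.103) p.34, in the tree as β's `QGQ_inv_eq` ∕ V-A), not its first-order Taylor term.  GENUINE: the full
`U ≡ 1` Landau-gauge `G = Δ_a⁻¹`, THE (1.66) matrix, b06's (2.152)–(2.157) engine, King's (4.39)–(4.41) mechanism, Combes–Thomas.  NOT [B9] Thm 3.15 at a general (3.35)-regular `U`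
(NOT PRINTED as an η-rate; G-B9-09∕10 stand), NOT Node 00's [B9] operator layer of record — **N15 is NOT discharged** (typed 28∕28 · discharged 5∕27 of record unchanged); one
finite four-torus programme at fixed `ε` — NOT ℝ⁴, NOT infinite volume, NOT OS, NOT a mass gap, NOT Clay.  Restate-immune (no Theses import).
-/

set_option autoImplicit false

noncomputable section

open scoped BigOperators Matrix
open Finset

namespace Summit.QuantumFields.YangMills.BalabanUVNodes.N15.UnitLayerBg

open Literature.MathematicalPhysics.QuantumFieldTheory.Balaban1983to89
open Literature.MathematicalPhysics.QuantumFieldTheory.Balaban1983to89.T4Continuum (T4Family ULoop)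
open Literature.MathematicalPhysics.QuantumFieldTheory.Balaban1983to89.T4EtaRate (PairedInstance NE2PlusOperator NE2PlusSite NE2PlusUnit EtaRateIneqUnit)
open Literature.MathematicalPhysics.QuantumFieldTheory.Balaban1983to89.T4EtaRateUnitWitness (covDiff)
open Literature.MathematicalPhysics.QuantumFieldTheory.Balaban1983to89.B5Prop11Plancherel (Tor fine)
open Literature.MathematicalPhysics.QuantumFieldTheory.Balaban1983to89.B6Lemma24Torus (pbox)
open Literature.MathematicalPhysics.QuantumFieldTheory.Balaban1983to89.B6BondEliminationTorus (pdist)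
open Literature.MathematicalPhysics.QuantumFieldTheory.Balaban1983to89.B6Cov2156Torus (deltaPol bondReductionT one_le_M)
open Literature.MathematicalPhysics.QuantumFieldTheory.Balaban1983to89.B6LowerBound2153Torus (rep rep_mem_pbox toT_rep)
open Literature.MathematicalPhysics.QuantumFieldTheory.Balaban1983to89.B6UnitTorusCarrier (unitTorusGeo pdist_rep_rep)
open Literature.MathematicalPhysics.QuantumFieldTheory.Balaban1983to89.B4Sect5Proof (latticeConst latticeConst_nonneg)
open Literature.MathematicalPhysics.QuantumFieldTheory.Balaban1983to89.NE2NodeTorus (ne2PlusOperator_reindex)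
open Literature.MathematicalPhysics.QuantumFieldTheory.King1986 (exp_decay_mono)
open Literature.MathematicalPhysics.QuantumFieldTheory.King1986.Torus (tdistT tdistT_nonneg)
open Node00 (NE2Objects₁₁)
open Summit.QuantumFields.BalabanUV.T4Continuum.HistoryFlow (two_le_L)
open Summit.QuantumFields.YangMills.BalabanUVNodes.N15.TwoGrid (gOp qvRe qvAdjRe TGIndex tgGeoC)
open Summit.QuantumFields.YangMills.BalabanUVNodes.N15.VectorPiece (kingPrV)
open Summit.QuantumFields.YangMills.BalabanUVNodes.N15.BackgroundLayer (bgPair projO stack unstack avg₁ fgD fgInstanceC2 fgFamilyC2 ne2PlusOperator_fullG_C2 projO_none_comp_stack)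
open Summit.QuantumFields.YangMills.BalabanUVNodes.N15.GenuineRecord (FGIndexL fgIndexL_nonempty tgSiteOn ne2PlusSite_tgSiteOn)
open Summit.QuantumFields.YangMills.BalabanUVNodes.N15.AtKeyedHome (s_N15_of_admits neZero_blockFactor)
open YMDAG.UVSplit (Datum NE2Carriers RateCarriers RateRecordPred N15At S_N15 ne2OfRecord₁₁)

variable {d : ℕ} {L : ℕ} [NeZero L]

/-! ## §1 The exactly dressed (2.156) covariance and the U-seeing unit-lattice kernel -/

section Kernel

/-- THE EXACT PERTURBATION OF THE (1.66) MATRIX BY A COEFFICIENT PAIR at fineness `n` on the unit torus `M`: `P_ex^{(n)}(c,a) = exDress b Δ^{(n)} (unitBondMat Z^{(n)}(c,a))`,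
`Z = Q(E₀ − G)Q*` (U-C), so that `Δ^{(n)} + P_ex = (Sym unitBondMat (Q E₀ Q*))⁻¹ − b` (`deltaPol_add_bgPertEx`). [cite: Balaban1984PropagatorsI, (1.65)–(1.66) p.29, (1.102)–(1.103) p.34] -/
def bgPertEx (M : Fin (d + 1) → ℕ) [∀ μ, NeZero (M μ)] (n : ℕ) [NeZero n] (b : ℝ) (c : Tor (fine n M) × Fin (d + 1) → ℝ) (a : Fin (d + 1) → Tor (fine n M) × Fin (d + 1) → ℝ) :
    Matrix (B4.Idx (pbox M) (d + 1)) (B4.Idx (pbox M) (d + 1)) ℝ :=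
  exDress b (deltaPol M n) (unitBondMat M (zOp d M n b c a))

/-- THE EXACTLY DRESSED (2.156) COVARIANCE at fineness `n`: `C(C*(Δ^{(n)} + P_ex^{(n)}(c,a))C)⁻¹C*` with b06's elimination matrix of the whole torus. [cite: Balaban1984PropagatorsII, (2.156) p.250 (object); Balaban1985BackgroundPropagators, (3.185)–(3.187) p.432 (shape of `C^{(k)}(U)`)] -/
def covBgEx (M : Fin (d + 1) → ℕ) [∀ μ, NeZero (M μ)] (n : ℕ) [NeZero n] (b : ℝ) (c : Tor (fine n M) × Fin (d + 1) → ℝ) (a : Fin (d + 1) → Tor (fine n M) × Fin (d + 1) → ℝ) :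
    Matrix (B4.Idx (pbox M) (d + 1)) (B4.Idx (pbox M) (d + 1)) ℝ :=
  (bondReductionT L M (deltaPol M n + bgPertEx M n b c a)).cov

section Dict

variable (M : Fin (d + 1) → ℕ) [∀ μ, NeZero (M μ)] (n : ℕ) [NeZero n] (b : ℝ)

omit [NeZero L] in
/-- ★ `unitBondMat (Q_n E₀(U) Q_n*) = unitBondMat (Q_n G_n Q_n*) + unitBondMat Z(U)` (`E₀ = G + W`, `Z = QWQ*`). [folklore] -/
theorem unitBondMat_qe0q (c : Tor (fine n M) × Fin (d + 1) → ℝ) (a : Fin (d + 1) → Tor (fine n M) × Fin (d + 1) → ℝ) :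
    unitBondMat M (qvRe M n ∘ₗ (e0Op d M n b c a ∘ₗ qvAdjRe M n)) = unitBondMat M (sOp M n b) + unitBondMat M (zOp d M n b c a) := by
  rw [← unitBondMat_add]
  congr 1
  rw [sOp_def, zOp, wOp, LinearMap.sub_comp, LinearMap.comp_sub]
  abel

omit [NeZero L] in
/-- ★★ **THE HONEST DICTIONARY — THE DRESSED FORM IS `Δ_k(U) = (Sym Q_nE₀(U)Q_n*)⁻¹ − b`**: `b·1 + Δ^{(n)} + P_ex^{(n)}(U) = (Sym unitBondMat (Q_n E₀^{(n)}(U) Q_n*))⁻¹` — Bałaban's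
definition of the effective operator ((1.65) via (1.102)–(1.103)) evaluated at the operator layer's own dressed propagator, symmetrised in the bond basis; NOT a Taylor term
(compare U-D's `bgPert = −Sym((b+Δ)Z(b+Δ))`). [cite: Balaban1984PropagatorsI, (1.65) p.29, (1.102)–(1.103) p.34; Balaban1985BackgroundPropagators, (3.185)–(3.187) p.432 (shape)] -/
theorem deltaPol_add_bgPertEx (hn : 1 ≤ n) (hb : 0 < b) (c : Tor (fine n M) × Fin (d + 1) → ℝ) (a : Fin (d + 1) → Tor (fine n M) × Fin (d + 1) → ℝ) :
    b • (1 : Matrix (B4.Idx (pbox M) (d + 1)) (B4.Idx (pbox M) (d + 1)) ℝ) + deltaPol M n + bgPertEx M n b c a =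
      (symPart (unitBondMat M (qvRe M n ∘ₗ (e0Op d M n b c a ∘ₗ qvAdjRe M n))))⁻¹ :=
  smul_one_add_deltaPol_add_exDress_eq_inv_symPart M n hn hb (unitBondMat_qe0q M n b c a)

omit [NeZero L] in
/-- ★★ **… EQUIVALENTLY `Δ_k(U) = (Q_n E₀ˢ(U) Q_n*)⁻¹ − b` WITH THE SYMMETRISED PROPAGATOR `E₀ˢ = ½(E₀ + E₀ᵀ)`** (V-C `symPart_unitBondMat_conj`: symmetrising in the bond basis IS
symmetrising the fine-lattice propagator, the weights of `Q*` cancel) — Bałaban's map `E ↦ (Q E Q*)⁻¹ − b` VERBATIM at a symmetric propagator. [cite: Balaban1984PropagatorsI, (1.65) p.29, (1.102)–(1.103) p.34] -/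
theorem deltaPol_add_bgPertEx_eq_inv_symProp (hn : 1 ≤ n) (hb : 0 < b) (c : Tor (fine n M) × Fin (d + 1) → ℝ) (a : Fin (d + 1) → Tor (fine n M) × Fin (d + 1) → ℝ) :
    b • (1 : Matrix (B4.Idx (pbox M) (d + 1)) (B4.Idx (pbox M) (d + 1)) ℝ) + deltaPol M n + bgPertEx M n b c a =
      (unitBondMat M (qvRe M n ∘ₗ (((2 : ℝ)⁻¹ • (e0Op d M n b c a + Matrix.toLin' (LinearMap.toMatrix' (e0Op d M n b c a))ᵀ)) ∘ₗ qvAdjRe M n)))⁻¹ := by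
  rw [deltaPol_add_bgPertEx M n b hn hb, symPart_unitBondMat_conj]

end Dict

/-- ★ **THE U-SEEING UNIT-LATTICE η-DIFFERENCE KERNEL, EXACT DRESSING** on dag-n15-c's primitive-carrier instance `fgInstanceC2 d hL i` (`i = ((m_T, k, m), ν)`):
`(U, y, y′) ↦ C_{ex}^{(L^mL^k)}(U)((ȳ,α),(ȳ′,β)) − C_{ex}^{(L^k)}(Ū)((ȳ,α),(ȳ′,β))`, `Ū = avg U` the pairing's block-averaged coarse partner (U-D `pair_avg_eq`).
[cite: Balaban1985BackgroundPropagators, Thm 3.15 (3.185)–(3.187) p.432 (shape of `C^{(k)}(Λ)(U)`); Balaban1984PropagatorsII, (2.156) p.250 (object at `U ≡ 1`)] -/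
def tgCovBgEx (d : ℕ) (hL : Odd L ∧ 1 < L) (b : ℝ) (α β : Fin (d + 1)) (i : TGIndex × Fin (d + 1)) : B9.SiteKernel (fgInstanceC2 d hL i).gc (fgInstanceC2 d hL i).Bf :=
  ⟨fun U y y' =>
    covBgEx (L := L) (TGIndex.Mn d hL i.1) (L ^ i.1.m * L ^ i.1.k) b U.1 U.2
        (⟨rep (TGIndex.Mn d hL i.1) y, rep_mem_pbox (TGIndex.Mn d hL i.1) y⟩, α) (⟨rep (TGIndex.Mn d hL i.1) y', rep_mem_pbox (TGIndex.Mn d hL i.1) y'⟩, β)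
      - covBgEx (L := L) (TGIndex.Mn d hL i.1) (L ^ i.1.k) b ((fgInstanceC2 d hL i).pair.avg U).1 ((fgInstanceC2 d hL i).pair.avg U).2
        (⟨rep (TGIndex.Mn d hL i.1) y, rep_mem_pbox (TGIndex.Mn d hL i.1) y⟩, α) (⟨rep (TGIndex.Mn d hL i.1) y', rep_mem_pbox (TGIndex.Mn d hL i.1) y'⟩, β)⟩

/-- Unfolding of `tgCovBgEx` (coarse partner = `avg₁ kingPrV U`). [folklore] -/
theorem tgCovBgEx_ker (hL : Odd L ∧ 1 < L) (b : ℝ) (α β : Fin (d + 1)) (i : TGIndex × Fin (d + 1)) (U : (fgInstanceC2 d hL i).Bf.Cfg) (y y' : Tor (TGIndex.Mn d hL i.1)) :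
    (tgCovBgEx d hL b α β i).ker U y y' =
      covBgEx (L := L) (TGIndex.Mn d hL i.1) (L ^ i.1.m * L ^ i.1.k) b U.1 U.2
          (⟨rep (TGIndex.Mn d hL i.1) y, rep_mem_pbox (TGIndex.Mn d hL i.1) y⟩, α) (⟨rep (TGIndex.Mn d hL i.1) y', rep_mem_pbox (TGIndex.Mn d hL i.1) y'⟩, β)
        - covBgEx (L := L) (TGIndex.Mn d hL i.1) (L ^ i.1.k) b (avg₁ (Fin (d + 1)) (kingPrV L i.1.k i.1.m (TGIndex.Mn d hL i.1)) U).1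
            (avg₁ (Fin (d + 1)) (kingPrV L i.1.k i.1.m (TGIndex.Mn d hL i.1)) U).2
          (⟨rep (TGIndex.Mn d hL i.1) y, rep_mem_pbox (TGIndex.Mn d hL i.1) y⟩, α) (⟨rep (TGIndex.Mn d hL i.1) y', rep_mem_pbox (TGIndex.Mn d hL i.1) y'⟩, β) := rfl

end Kernel

/-! ## §1b Consistency at `U ≡ 1`: no background, no dressing — the kernel IS the genuine (2.156) difference -/

section AtOne

variable (M : Fin (d + 1) → ℕ) [∀ μ, NeZero (M μ)] (n : ℕ) [NeZero n]

omit [NeZero L] in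
/-- At zero coefficients the exact perturbation vanishes: `P_ex^{(n)}(0) = 0` (`n ≥ 1`, `b > 0`; U-D `zOp_zero` + V-C `exDress_deltaPol_zero`). [folklore] -/
theorem bgPertEx_zero (hn : 1 ≤ n) {b : ℝ} (hb : 0 < b) : bgPertEx M n b (fun _ => 0) (fun _ _ => 0) = 0 := by
  unfold bgPertEx; rw [zOp_zero, unitBondMat_zero, exDress_deltaPol_zero n M hn hb]

/-- ★ **AT `U ≡ 1` THE U-SEEING KERNEL IS THE GENUINE (2.156) DIFFERENCE**: the primitive carrier's `one` is the zero coefficient pair, whose block average is zero; both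
perturbations vanish and `tgCovBgEx … .ker one y y′ = C^{(L^mL^k)} − C^{(L^k)}` at the bonds — part 76's `covDiff` (`b > 0`). [cite: Balaban1984PropagatorsII, (2.156) p.250 (object)] -/
theorem tgCovBgEx_one (hL : Odd L ∧ 1 < L) {b : ℝ} (hb : 0 < b) (α β : Fin (d + 1)) (i : TGIndex × Fin (d + 1)) (y y' : Tor (TGIndex.Mn d hL i.1)) :
    (tgCovBgEx d hL b α β i).ker (fgInstanceC2 d hL i).Bf.one y y' =
      covDiff L (TGIndex.Mn d hL i.1) i.1.k i.1.m (⟨rep (TGIndex.Mn d hL i.1) y, rep_mem_pbox (TGIndex.Mn d hL i.1) y⟩, α)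
        (⟨rep (TGIndex.Mn d hL i.1) y', rep_mem_pbox (TGIndex.Mn d hL i.1) y'⟩, β) := by
  have hL1 : 1 ≤ L := by have := hL.2; omega
  have hLk : 1 ≤ L ^ i.1.k := Nat.one_le_pow _ _ hL1
  have hLmk : 1 ≤ L ^ i.1.m * L ^ i.1.k := Nat.one_le_iff_ne_zero.mpr (Nat.mul_ne_zero (by have := Nat.one_le_pow i.1.m L hL1; omega) (by omega))
  have h1 : (fgInstanceC2 d hL i).Bf.one = ((fun _ => 0, fun _ _ => 0) : (Tor (fine (L ^ i.1.m * L ^ i.1.k) (TGIndex.Mn d hL i.1)) × Fin (d + 1) → ℝ) ×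
      (Fin (d + 1) → Tor (fine (L ^ i.1.m * L ^ i.1.k) (TGIndex.Mn d hL i.1)) × Fin (d + 1) → ℝ)) := rfl
  have havg : avg₁ (Fin (d + 1)) (kingPrV L i.1.k i.1.m (TGIndex.Mn d hL i.1))
      ((fun _ => 0, fun _ _ => 0) : (Tor (fine (L ^ i.1.m * L ^ i.1.k) (TGIndex.Mn d hL i.1)) × Fin (d + 1) → ℝ) ×
        (Fin (d + 1) → Tor (fine (L ^ i.1.m * L ^ i.1.k) (TGIndex.Mn d hL i.1)) × Fin (d + 1) → ℝ))
      = ((fun _ => 0, fun _ _ => 0) : (Tor (fine (L ^ i.1.k) (TGIndex.Mn d hL i.1)) × Fin (d + 1) → ℝ) ×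
        (Fin (d + 1) → Tor (fine (L ^ i.1.k) (TGIndex.Mn d hL i.1)) × Fin (d + 1) → ℝ)) :=
    BackgroundLayer.avg₁_zero (Fin (d + 1)) _
  rw [tgCovBgEx_ker, h1, havg]
  show covBgEx (L := L) (TGIndex.Mn d hL i.1) (L ^ i.1.m * L ^ i.1.k) b (fun _ => 0) (fun _ _ => 0) _ _
      - covBgEx (L := L) (TGIndex.Mn d hL i.1) (L ^ i.1.k) b (fun _ => 0) (fun _ _ => 0) _ _ = _
  unfold covBgEx covDiff
  rw [bgPertEx_zero _ _ hLmk hb, bgPertEx_zero _ _ hLk hb, add_zero, add_zero, show L ^ i.1.m * L ^ i.1.k = L ^ (i.1.k + i.1.m) by rw [pow_add, mul_comm]]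

end AtOne

/-! ## §2 `NE2PlusUnit` by name with the background LIVE through the exact dressing, window-free -/

section UnitLayer

/-- ★★★ **`NE2PlusUnit` — THE NODE's THIRD CONJUNCT BY NAME — WITH THE BACKGROUND LIVE THROUGH THE EXACT (1.103) DRESSING, WINDOW-FREE**, on dag-n15-c's primitive-carrier
family over the L-divisible tori of the family of record: for `d ≥ 1`, odd `L ≥ 3`, `b > 0`, `c₃₅ > 0` and every direction pair `α β`,
`NE2PlusUnit c₃₅ (fgInstanceC2 d hL ∘ val) (tgCovBgEx d hL b α β ∘ val) ⊤ dist` — constants `(δ₀, a₀, B₀, θ = L^{−1∕16})` after `d, L, b, c₃₅`.  The kernel READS `U`: the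
fine run's (2.156) covariance is built on `Δ_{k+m}(U) = (Sym Q′E₀′(U)Q′*)⁻¹ − b`, the coarse run's on `Δ_k(Ū) = (Sym QE₀(Ū)Q*)⁻¹ − b`, `Ū` the pairing's block average; the
threshold `a₀ = min a₁ (min (ζ₀∕ζ) (ε₀∕(Kζ)))` is a smallness in `α₀` ALONE (V-C's Combes–Thomas margin `ζ₀`, U-A's (2.153) margin `epsCov`); the inverses exist by
coercivity (`b∕((b+c₀)V₁+1)²` minus a Schur bound) and by the PRINTED positivity (2.153)∕(2.157) — NO weight window, NO Neumann series; the (3.36) hypothesis is idle (said).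
Chain: U-C3 `zOp_family_letters` → V-C `exDress_deltaPol_letters` → U-A `cov2156_rate_torus_add`. [cite: Balaban1985BackgroundPropagators, Thm 3.15 (3.185)–(3.187) p.432
(quantifier template, shape); Balaban1984PropagatorsII, (2.153)–(2.157) pp.249–250 (positivity, object); Balaban1984PropagatorsI, (1.102)–(1.103) p.34 (the dressing map);
King1986, Lemma 4.5 (4.38)–(4.41) pp.674–675 (shape, mechanism); CombesThomas1973, §II (mechanism)] -/
theorem ne2PlusUnit_tgCovBgEx (hd : 1 ≤ d) (hLodd : Odd L) (hL2 : 2 ≤ L) (hL : Odd L ∧ 1 < L) {b : ℝ} (hb : 0 < b) {c35 : ℝ} (hc35 : 0 < c35) (α β : Fin (d + 1)) :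
    NE2PlusUnit c35 (fun i : FGIndexL d => fgInstanceC2 d hL i.1) (fun i => tgCovBgEx d hL b α β i.1) (fun _ _ => True) (fun i => (tgGeoC d hL i.1.1).dist) := by
  have hL1 : 1 ≤ L := by omega
  have hL1r : (1 : ℝ) ≤ (L : ℝ) := by exact_mod_cast hL1
  have hL0r : (0 : ℝ) ≤ (L : ℝ) := by positivity
  obtain ⟨δZ, ζ, τ, a₁, hδZ, hζ, hτ, ha₁, HZ⟩ := zOp_family_letters (d := d) hLodd hL2 hL hb c35 hc35
  obtain ⟨K, δ', ζ₀, hK, hδ', hζ₀, HP⟩ := exDress_deltaPol_letters (d + 1) (by omega) hb hδZ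
  obtain ⟨C', δ'', hC', hδ'', HC⟩ := cov2156_rate_torus_add (d + 1) (by omega) hL1 (δP := δ') hδ'
  have hε₀ := epsCov_pos (d := d + 1) (L := L) (by omega) hL1 hδ'
  have hKζ : 0 < K * ζ := by positivity
  -- the threshold a₀ and the constants
  obtain ⟨a₀, ha₀def⟩ : ∃ a₀ : ℝ, a₀ = min a₁ (min (ζ₀ / ζ) (epsCov (d + 1) L δ' / (K * ζ))) := ⟨_, rfl⟩
  have ha₀ : 0 < a₀ := by rw [ha₀def]; exact lt_min ha₁ (lt_min (div_pos hζ₀ hζ) (div_pos hε₀ hKζ))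
  refine ⟨δ'', a₀, C' * (1 + K * (τ + 1)) + 1, (L : ℝ) ^ (-(1 / 16 : ℝ)), hδ'', ha₀, by positivity, Real.rpow_pos_of_pos (by positivity) _,
    Real.rpow_lt_one_of_one_lt_of_neg (by exact_mod_cast hL2) (by norm_num), fun i α₀ hα₀ hMα U hreg _ y y' _ _ => ?_⟩
  -- the index data
  have hM1 : (fgInstanceC2 d hL i.1).gf.M = 1 := rfl
  rw [hM1, one_mul] at hMα
  have hαa₁ : α₀ ≤ a₁ := hMα.trans (by rw [ha₀def]; exact min_le_left _ _)
  have hαζ₀ : ζ * α₀ ≤ ζ₀ := by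
    have h1 : α₀ ≤ ζ₀ / ζ := hMα.trans (by rw [ha₀def]; exact (min_le_right _ _).trans (min_le_left _ _))
    have h2 := mul_le_mul_of_nonneg_left h1 hζ.le
    rwa [mul_div_cancel₀ _ hζ.ne'] at h2
  have hαε : K * (ζ * α₀) ≤ epsCov (d + 1) L δ' := by
    have h1 : α₀ ≤ epsCov (d + 1) L δ' / (K * ζ) := hMα.trans (by rw [ha₀def]; exact (min_le_right _ _).trans (min_le_right _ _))
    have h2 := mul_le_mul_of_nonneg_left h1 hKζ.le
    rw [mul_div_cancel₀ _ hKζ.ne'] at h2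
    calc K * (ζ * α₀) = K * ζ * α₀ := by ring
      _ ≤ epsCov (d + 1) L δ' := h2
  have hLk : 1 ≤ L ^ i.1.1.k := Nat.one_le_pow _ _ hL1
  have hLm : 1 ≤ L ^ i.1.1.m := Nat.one_le_pow _ _ hL1
  have hLkr : (0 : ℝ) < (L : ℝ) ^ i.1.1.k := by positivity
  have ht0 : 0 ≤ ((L : ℝ) ^ i.1.1.k) ^ (-(1 / 16 : ℝ)) := Real.rpow_nonneg hLkr.le _
  have htinv : (((L ^ i.1.1.k : ℕ) : ℝ))⁻¹ ≤ ((L : ℝ) ^ i.1.1.k) ^ (-(1 / 16 : ℝ)) := by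
    have h := inv_pow_le_sixteenth (L := L) hL1r i.1.1.k
    have e : (((L ^ i.1.1.k : ℕ) : ℝ)) = (L : ℝ) ^ i.1.1.k := by push_cast; ring
    rwa [e]
  have hn0 : 0 ≤ (((L ^ i.1.1.k : ℕ) : ℝ))⁻¹ := by positivity
  -- U-C3: the middle factor's letters
  obtain ⟨hZ1, hZ2, hZ3⟩ := HZ i.1 α₀ hα₀ hαa₁ U hreg
  -- V-C: the exact perturbation letters
  obtain ⟨hS1, hS2, hP1, hP2, hP12⟩ := HP (TGIndex.Mn d hL i.1.1) (L ^ i.1.1.k) (L ^ i.1.1.m * L ^ i.1.1.k) (L ^ i.1.1.m) hLk hLm rfl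
    (unitBondMat (TGIndex.Mn d hL i.1.1) (zOp d (TGIndex.Mn d hL i.1.1) (L ^ i.1.1.k) b
      (avg₁ (Fin (d + 1)) (kingPrV L i.1.1.k i.1.1.m (TGIndex.Mn d hL i.1.1)) U).1 (avg₁ (Fin (d + 1)) (kingPrV L i.1.1.k i.1.1.m (TGIndex.Mn d hL i.1.1)) U).2))
    (unitBondMat (TGIndex.Mn d hL i.1.1) (zOp d (TGIndex.Mn d hL i.1.1) (L ^ i.1.1.m * L ^ i.1.1.k) b U.1 U.2))
    (ζ * α₀) (τ * ((L : ℝ) ^ i.1.1.k) ^ (-(1 / 16 : ℝ))) (by positivity) hαζ₀ (by positivity) hZ1 hZ2 hZ3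
  -- U-A: the perturbed covariance rate
  have hcov := HC (TGIndex.Mn d hL i.1.1) (dvd_Mn_fg (d := d) hL i) (L ^ i.1.1.k) (L ^ i.1.1.m * L ^ i.1.1.k) (L ^ i.1.1.m) hLk hLm rfl
    (bgPertEx (TGIndex.Mn d hL i.1.1) (L ^ i.1.1.k) b (avg₁ (Fin (d + 1)) (kingPrV L i.1.1.k i.1.1.m (TGIndex.Mn d hL i.1.1)) U).1
      (avg₁ (Fin (d + 1)) (kingPrV L i.1.1.k i.1.1.m (TGIndex.Mn d hL i.1.1)) U).2)
    (bgPertEx (TGIndex.Mn d hL i.1.1) (L ^ i.1.1.m * L ^ i.1.1.k) b U.1 U.2) hS1 hS2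
    (K * (ζ * α₀)) (K * (τ * ((L : ℝ) ^ i.1.1.k) ^ (-(1 / 16 : ℝ)) + (((L ^ i.1.1.k : ℕ) : ℝ))⁻¹))
    (by positivity) hαε (by positivity) hP1 hP2 hP12
    (⟨rep (TGIndex.Mn d hL i.1.1) y, rep_mem_pbox (TGIndex.Mn d hL i.1.1) y⟩, α) (⟨rep (TGIndex.Mn d hL i.1.1) y', rep_mem_pbox (TGIndex.Mn d hL i.1.1) y'⟩, β)
  have hdist : pdist (TGIndex.Mn d hL i.1.1) (one_le_M (TGIndex.Mn d hL i.1.1)) (rep (TGIndex.Mn d hL i.1.1) y) (rep (TGIndex.Mn d hL i.1.1) y')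
      = tdistT (TGIndex.Mn d hL i.1.1) y y' := pdist_rep_rep _ _ y y'
  rw [tgCovBgEx_ker]
  show |covBgEx (L := L) (TGIndex.Mn d hL i.1.1) (L ^ i.1.1.m * L ^ i.1.1.k) b U.1 U.2 _ _
      - covBgEx (L := L) (TGIndex.Mn d hL i.1.1) (L ^ i.1.1.k) b _ _ _ _|
    ≤ (C' * (1 + K * (τ + 1)) + 1) * Real.exp (-(δ'' * tdistT (TGIndex.Mn d hL i.1.1) y y')) * ((L : ℝ) ^ (-(1 / 16 : ℝ))) ^ i.1.1.k
  unfold covBgEx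
  refine hcov.trans ?_
  rw [← rpow_pow_eq hL0r, ← hdist]
  have hE := Real.exp_nonneg (-(δ'' * pdist (TGIndex.Mn d hL i.1.1) (one_le_M (TGIndex.Mn d hL i.1.1)) (rep (TGIndex.Mn d hL i.1.1) y) (rep (TGIndex.Mn d hL i.1.1) y')))
  -- the amplitude against t = (L^k)^{−1/16}
  have hamp : C' * ((((L ^ i.1.1.k : ℕ) : ℝ))⁻¹ + K * (τ * ((L : ℝ) ^ i.1.1.k) ^ (-(1 / 16 : ℝ)) + (((L ^ i.1.1.k : ℕ) : ℝ))⁻¹))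
      ≤ (C' * (1 + K * (τ + 1)) + 1) * ((L : ℝ) ^ i.1.1.k) ^ (-(1 / 16 : ℝ)) := by
    have h2 : K * (τ * ((L : ℝ) ^ i.1.1.k) ^ (-(1 / 16 : ℝ)) + (((L ^ i.1.1.k : ℕ) : ℝ))⁻¹) ≤ K * (τ + 1) * ((L : ℝ) ^ i.1.1.k) ^ (-(1 / 16 : ℝ)) := by
      have := add_le_add (le_refl (τ * ((L : ℝ) ^ i.1.1.k) ^ (-(1 / 16 : ℝ)))) htinv
      calc K * (τ * ((L : ℝ) ^ i.1.1.k) ^ (-(1 / 16 : ℝ)) + (((L ^ i.1.1.k : ℕ) : ℝ))⁻¹)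
          ≤ K * (τ * ((L : ℝ) ^ i.1.1.k) ^ (-(1 / 16 : ℝ)) + ((L : ℝ) ^ i.1.1.k) ^ (-(1 / 16 : ℝ))) := mul_le_mul_of_nonneg_left this hK.le
        _ = K * (τ + 1) * ((L : ℝ) ^ i.1.1.k) ^ (-(1 / 16 : ℝ)) := by ring
    calc C' * ((((L ^ i.1.1.k : ℕ) : ℝ))⁻¹ + K * (τ * ((L : ℝ) ^ i.1.1.k) ^ (-(1 / 16 : ℝ)) + (((L ^ i.1.1.k : ℕ) : ℝ))⁻¹))
        ≤ C' * (((L : ℝ) ^ i.1.1.k) ^ (-(1 / 16 : ℝ)) + K * (τ + 1) * ((L : ℝ) ^ i.1.1.k) ^ (-(1 / 16 : ℝ))) := mul_le_mul_of_nonneg_left (add_le_add htinv h2) hC'.le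
      _ = (C' * (1 + K * (τ + 1))) * ((L : ℝ) ^ i.1.1.k) ^ (-(1 / 16 : ℝ)) := by ring
      _ ≤ _ := mul_le_mul_of_nonneg_right (by linarith) ht0
  calc C' * ((((L ^ i.1.1.k : ℕ) : ℝ))⁻¹ + K * (τ * ((L : ℝ) ^ i.1.1.k) ^ (-(1 / 16 : ℝ)) + (((L ^ i.1.1.k : ℕ) : ℝ))⁻¹)) *
        Real.exp (-(δ'' * pdist (TGIndex.Mn d hL i.1.1) (one_le_M (TGIndex.Mn d hL i.1.1)) (rep (TGIndex.Mn d hL i.1.1) y) (rep (TGIndex.Mn d hL i.1.1) y')))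
      ≤ (C' * (1 + K * (τ + 1)) + 1) * ((L : ℝ) ^ i.1.1.k) ^ (-(1 / 16 : ℝ)) *
        Real.exp (-(δ'' * pdist (TGIndex.Mn d hL i.1.1) (one_le_M (TGIndex.Mn d hL i.1.1)) (rep (TGIndex.Mn d hL i.1.1) y) (rep (TGIndex.Mn d hL i.1.1) y'))) :=
        mul_le_mul_of_nonneg_right hamp hE
    _ = _ := by ring

end UnitLayer

/-! ## §3 `N15At` for the primitive-carrier family with TWO U-seeing layers (exact dressing); the `NE2Objects₁₁` literal; keyed faces -/

section Record

/-- ★★★ **`N15At` — ALL THREE CONJUNCTS BY NAME, NO DISPLAYED BINDER, TWO OF THEM READING THE BACKGROUND (unit layer EXACTLY dressed).**  For `d ≥ 1`, odd `L ≥ 3`,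
`b, a_S > 0`, `c₃₅ > 0`, directions `α β`, every `p`: `N15At ⟨FGIndexL d, c₃₅, p, fgInstanceC2 ∘ val, fgFamilyC2 b ∘ val, tgSiteOn a_S …, tgCovBgEx b α β ∘ val, ⊤, dist⟩` —
OPERATOR = n15-c FILE 11 `ne2PlusOperator_fullG_C2` (background LIVE over the primitive letters), UNIT = §2 `ne2PlusUnit_tgCovBgEx` (background LIVE through
`Δ_k(U) = (Sym QE₀(U)Q*)⁻¹ − b`), SITE = dag-n15-c G1's genuine `U ≡ 1` scalar-sector kernel (U-BLIND — dag-n15-d∕-e's lane; said). [bookkeeping] -/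
theorem n15At_fullG_C2_bgEx (hd : 1 ≤ d) (hLodd : Odd L) (hL2 : 2 ≤ L) (hL : Odd L ∧ 1 < L) {b aS : ℝ} (hb : 0 < b) (haS : 0 < aS) {c35 : ℝ} (hc35 : 0 < c35)
    (α β : Fin (d + 1)) (p : ℝ) :
    N15At { I := FGIndexL d, c35 := c35, p := p, pi := fun i => fgInstanceC2 d hL i.1,
            Kop := fun i => fgFamilyC2 d hL b i.1,
            Ksite := tgSiteOn d hL aS (fun i : FGIndexL d => i.1.1) (fun i => (fgInstanceC2 d hL i.1).Bf),
            Kunit := fun i => tgCovBgEx d hL b α β i.1,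
            inΛ := fun _ _ => True, unitDist := fun i => (tgGeoC d hL i.1.1).dist } :=
  ⟨ne2PlusOperator_reindex (Subtype.val : FGIndexL d → TGIndex × Fin (d + 1)) (ne2PlusOperator_fullG_C2 d hd hLodd hL2 hL hb c35 hc35),
   ne2PlusSite_tgSiteOn (d := d) (fun i : FGIndexL d => i.1.1) (fun i => (fgInstanceC2 d hL i.1).gf) (fun i => (fgInstanceC2 d hL i.1).Bc)
     (fun i => (fgInstanceC2 d hL i.1).Bf) hLodd hL2 hL haS (fun i => (fgInstanceC2 d hL i.1).pair) 4 p c35,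
   ne2PlusUnit_tgCovBgEx (d := d) hd hLodd hL2 hL hb hc35 α β⟩

/-- **N15's NE2 OBJECTS OF THE PRIMITIVE-CARRIER FAMILY WITH THE EXACTLY DRESSED U-SEEING UNIT LAYER** (RR-1's layer-A container): as U-D's `c2BgObjects` with the unit kernel
`tgCovBgEx b α β`. [bookkeeping] -/
def c2BgExObjects (d : ℕ) (hL : Odd L ∧ 1 < L) (b aS : ℝ) (α β : Fin (d + 1)) (c35 p : ℝ) : NE2Objects₁₁ where
  I := FGIndexL d
  c35 := c35
  p := p
  pi := fun i => fgInstanceC2 d hL i.1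
  Kop := fun i => fgFamilyC2 d hL b i.1
  Ksite := tgSiteOn d hL aS (fun i : FGIndexL d => i.1.1) (fun i => (fgInstanceC2 d hL i.1).Bf)
  Kunit := fun i => tgCovBgEx d hL b α β i.1
  inΛ := fun _ _ => True
  unitDist := fun i => (tgGeoC d hL i.1.1).dist

/-- The home's NE2 bundle of the objects IS §3's record (`rfl`). [bookkeeping] -/
theorem ne2OfRecord₁₁_c2BgExObjects (hL : Odd L ∧ 1 < L) (b aS : ℝ) (α β : Fin (d + 1)) (c35 p : ℝ) :
    ne2OfRecord₁₁ (c2BgExObjects d hL b aS α β c35 p) =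
      { I := FGIndexL d, c35 := c35, p := p, pi := fun i => fgInstanceC2 d hL i.1,
        Kop := fun i => fgFamilyC2 d hL b i.1,
        Ksite := tgSiteOn d hL aS (fun i : FGIndexL d => i.1.1) (fun i => (fgInstanceC2 d hL i.1).Bf),
        Kunit := fun i => tgCovBgEx d hL b α β i.1,
        inΛ := fun _ _ => True, unitDist := fun i => (tgGeoC d hL i.1.1).dist } := rfl

/-- ★★★ **`N15At` AT THE OBJECTS' BUNDLE** (`c₃₅ > 0`). [bookkeeping] -/
theorem n15At_c2BgExObjects (hd : 1 ≤ d) (hLodd : Odd L) (hL2 : 2 ≤ L) (hL : Odd L ∧ 1 < L) {b aS : ℝ} (hb : 0 < b) (haS : 0 < aS) {c35 : ℝ} (hc35 : 0 < c35)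
    (α β : Fin (d + 1)) (p : ℝ) : N15At (ne2OfRecord₁₁ (c2BgExObjects d hL b aS α β c35 p)) :=
  n15At_fullG_C2_bgEx (d := d) hd hLodd hL2 hL hb haS hc35 α β p

/-- **RR-1's DISPLAY HOLDS AT THE LITERAL**: `Populated`. [bookkeeping] -/
theorem populated_c2BgExObjects (hL : Odd L ∧ 1 < L) (b aS : ℝ) (α β : Fin (d + 1)) (c35 p : ℝ) :
    (c2BgExObjects d hL b aS α β c35 p).Populated :=
  (NE2Objects₁₁.populated_iff _).2 fgIndexL_nonempty

variable {N : ℕ} [NeZero N] {key : (F : T4Family) → Datum F N → Prop}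

/-- ★★ **THE READING CLOSES THE STUB AT ANY KEYED HOME** (part 30's interface; `d ≥ 1`, odd `L ≥ 3`, `b, a_S > 0`, `c₃₅ > 0`). [bookkeeping] -/
theorem s_N15_of_admits_C2BgEx (hd : 1 ≤ d) (hLodd : Odd L) (hL2 : 2 ≤ L) (hL : Odd L ∧ 1 < L) {b aS : ℝ} (hb : 0 < b) (haS : 0 < aS) {c35 : ℝ} (hc35 : 0 < c35)
    (α β : Fin (d + 1)) (p : ℝ)
    (ne2At : ∀ {F : T4Family} {D : Datum F N}, key F D → (ℕ → ℝ) → List (ULoop F) → ℕ → NE2Objects₁₁) (RRec : RateRecordPred N)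
    (hadm : ∀ (F : T4Family) (D : Datum F N) (g₀ : ℕ → ℝ) (os : List (ULoop F)) (R : RateCarriers N), RRec F D g₀ os R →
      ∃ (h : key F D) (k : ℕ), R.ne2 = ne2OfRecord₁₁ (ne2At h g₀ os k))
    (h : ∀ (F : T4Family) (D : Datum F N) (h : key F D) (g₀ : ℕ → ℝ) (os : List (ULoop F)) (k : ℕ), ne2At h g₀ os k = c2BgExObjects d hL b aS α β c35 p) :
    S_N15 RRec := by
  refine s_N15_of_admits ne2At RRec hadm fun F D hk g₀ os k => ?_
  rw [h F D hk g₀ os k]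
  exact n15At_c2BgExObjects (d := d) hd hLodd hL2 hL hb haS hc35 α β p

/-- ★★ **THE FAMILY-KEYED READING CLOSES THE STUB AT ANY KEYED HOME** (`d + 1 = 4`; `fgInstanceC2 3 F.hL`, block factor `F.L`). [bookkeeping] -/
theorem s_N15_of_admits_C2BgEx_family {b aS : ℝ} (hb : 0 < b) (haS : 0 < aS) {c35 : ℝ} (hc35 : 0 < c35) (α β : Fin 4) (p : ℝ)
    (ne2At : ∀ {F : T4Family} {D : Datum F N}, key F D → (ℕ → ℝ) → List (ULoop F) → ℕ → NE2Objects₁₁) (RRec : RateRecordPred N)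
    (hadm : ∀ (F : T4Family) (D : Datum F N) (g₀ : ℕ → ℝ) (os : List (ULoop F)) (R : RateCarriers N), RRec F D g₀ os R →
      ∃ (h : key F D) (k : ℕ), R.ne2 = ne2OfRecord₁₁ (ne2At h g₀ os k))
    (h : ∀ (F : T4Family) (D : Datum F N) (h : key F D) (g₀ : ℕ → ℝ) (os : List (ULoop F)) (k : ℕ),
      ne2At h g₀ os k = haveI := neZero_blockFactor F; c2BgExObjects 3 F.hL b aS α β c35 p) :
    S_N15 RRec := by
  refine s_N15_of_admits ne2At RRec hadm fun F D hk g₀ os k => ?_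
  rw [h F D hk g₀ os k]
  haveI := neZero_blockFactor F
  exact n15At_c2BgExObjects (d := 3) (by norm_num) F.hL.1 (two_le_L F) F.hL hb haS hc35 α β p

/-- **RR-1's DISPLAY AT THE FAMILY-KEYED LITERAL**. [bookkeeping] -/
theorem populated_c2BgExObjects_family (F : T4Family) (b aS : ℝ) (α β : Fin 4) (c35 p : ℝ) :
    (haveI := neZero_blockFactor F; c2BgExObjects 3 F.hL b aS α β c35 p).Populated := by
  haveI := neZero_blockFactor F
  exact populated_c2BgExObjects F.hL b aS α β c35 p

/-- `N15At` at the family-keyed literal (`(3, F.hL)`; `c₃₅ > 0`). [bookkeeping] -/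
theorem n15At_c2BgExObjects_family {b aS : ℝ} (hb : 0 < b) (haS : 0 < aS) {c35 : ℝ} (hc35 : 0 < c35) (α β : Fin 4) (p : ℝ) (F : T4Family) :
    N15At (ne2OfRecord₁₁ (haveI := neZero_blockFactor F; c2BgExObjects 3 F.hL b aS α β c35 p)) := by
  haveI := neZero_blockFactor F
  exact n15At_c2BgExObjects (d := 3) (by norm_num) F.hL.1 (two_le_L F) F.hL hb haS hc35 α β p

end Record

end Summit.QuantumFields.YangMills.BalabanUVNodes.N15.UnitLayerBg

end
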